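import Mathlib
import Literature.AlgebraicGeometry.Resolution.WeakJacobianDerivations
import Literature.AlgebraicGeometry.Resolution.DerivationCompletion

/-!
# Derivations of `k[X]` dual to prescribed elements of a prime, modulo the prime

Helper file for the stub `stub_pthPowerModMonomial` of the line `pfaff-line-log-final-forms`
(crux `Valuative.LuAlphaPTorsor`, item `stmt-ResolutionOfSingularities-0641`): the supply of
`ℤ`-derivations of a local ring essentially of finite type over a field `k` (of any
characteristic) is manufactured from derivations of the polynomial ring `S = k[X_1, …, X_n]`.

* `exists_derivation_of_leibniz` — an additive map with the Leibniz rule is a `ℤ`-derivation,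
  for ANY `ℤ`-algebra / `ℤ`-module structures (localizations carry their own; all agree).
* `exists_derivations_apply_sub_mem` — **the Jacobian supply** (the mechanism of Matsumura's
  proof of Thm. 30.5 = Zariski's Jacobian criterion, as run in the tree's
  `WeakJacobianPolynomial.lean` for a basis of `𝔪/𝔪²`; here for any elements `g_1, …, g_r ∈ 𝔮`
  whose classes in the cotangent space `𝔪/𝔪²` of `S_𝔮` are linearly INDEPENDENT): there are
  `D_1, …, D_r ∈ Der(S)` and `c₀ ∉ 𝔮` with `D_i(g_j) ≡ c₀ δ_ij mod 𝔮`. The coordinate functionals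
  of the `ḡ_j` come from derivations `S_𝔮 → κ(𝔮)` (Cohen, `exists_derivation_apply_eq`), and a
  derivation `S → κ(𝔮)` is rebuilt, up to the common denominator `c₀`, from a derivation of `k`
  (through a basis of `Ω_{k/ℤ}` adapted to the coefficients of the `g_j`) and its values on the
  variables (`MvPolynomial.exists_derivation_C_eq_X_eq`).
* `exists_derivation_localization` — a derivation of `S` extends to `S_𝔮` (Stacks 07PE).
* `exists_derivation_of_surjective` — a derivation of a ring `Q` preserving the kernel of a
  surjection `Q → R` descends to `R`.

The generic `ℤ`-structures get priority in this file (as in `DerivationCompletion.lean`), except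
on the abstract target ring `R`, whose `ℤ`-algebra structure is a section variable.
-/

set_option linter.dupNamespace false

attribute [local instance 1100] Ring.toIntAlgebra AddCommGroup.toIntModule

namespace Summit.ResolutionOfSingularities.ResolutionOfSingularities.Theorems.PfaffLine

open IsLocalRing MvPolynomial Literature.AlgebraicGeometry.Resolution

universe u v

/-! ## Repackaging additive Leibniz maps as `ℤ`-derivations -/

/-- An additive map satisfying the Leibniz rule is (the underlying map of) a `ℤ`-derivation,
whatever the `ℤ`-algebra structure of the source and the `ℤ`-module structure of the target
(all such structures act through the integers, `map_intCast_smul`). [folklore] -/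
theorem exists_derivation_of_leibniz {A : Type u} [CommRing A] [Algebra ℤ A] {M : Type v}
    [AddCommGroup M] [Module A M] [Module ℤ M] (f : A →+ M)
    (h : ∀ a b, f (a * b) = a • f b + b • f a) : ∃ D : Derivation ℤ A M, ∀ a, D a = f a :=
  ⟨{ toFun := f
     map_add' := f.map_add
     map_smul' := fun c a =>
       @map_intCast_smul A M _ _ (A →+ M) _ _ f ℤ ℤ _ _ Algebra.toModule ‹Module ℤ M› c a
     map_one_eq_zero' := by
       have := h 1 1
       rw [mul_one, one_smul] at this
       simpa using this
     leibniz' := h }, fun _ => rfl⟩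

/-- Evaluating a finite sum of derivations. [folklore] -/
theorem sum_derivation_apply {A : Type u} [CommRing A] [Algebra ℤ A] {M : Type v} [AddCommGroup M]
    [Module A M] [Module ℤ M] {ι : Type*} (s : Finset ι) (f : ι → Derivation ℤ A M) (y : A) :
    (∑ l ∈ s, f l) y = ∑ l ∈ s, f l y := by
  induction s using Finset.cons_induction with
  | empty => simp
  | cons a s ha ih => rw [Finset.sum_cons, Finset.sum_cons, Derivation.add_apply, ih]

/-! ## The Jacobian supply of derivations of `k[X_1, …, X_n]` -/

section Jacobian

variable (k : Type u) [Field k] (n : ℕ)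

/-- **Derivations of `S = k[X_1, …, X_n]` dual, modulo a prime `𝔮`, to elements of `𝔮` with
linearly independent differentials.** If `g_1, …, g_r ∈ 𝔮` have linearly independent classes in
the cotangent space `𝔪/𝔪²` of `S_𝔮` (over `κ(𝔮)`), there are `D_1, …, D_r ∈ Der(S)` and
`c₀ ∈ S ∖ 𝔮` with `D_i(g_j) - c₀ δ_ij ∈ 𝔮`. (Matsumura, proof of Thm. 30.5: the differentials
`dg_j` are independent in `Ω_{S_𝔮} ⊗ κ(𝔮)`, and derivations of `S` realise, up to a common
denominator, any `κ(𝔮)`-valued derivation on finitely many elements.)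
(Matsumura, *Commutative Ring Theory*, proof of Thm. 30.5 with Thm. 25.2.) [folklore] -/
theorem exists_derivations_apply_sub_mem (𝔮 : Ideal (MvPolynomial (Fin n) k)) [hP : 𝔮.IsPrime]
    {r : ℕ} (g : Fin r → MvPolynomial (Fin n) k)
    (hg : ∀ j, algebraMap _ (Localization.AtPrime 𝔮) (g j) ∈ maximalIdeal (Localization.AtPrime 𝔮))
    (hli : LinearIndependent 𝔮.ResidueField fun j =>
      (maximalIdeal (Localization.AtPrime 𝔮)).toCotangent ⟨_, hg j⟩) :
    ∃ (D : Fin r → Derivation ℤ (MvPolynomial (Fin n) k) (MvPolynomial (Fin n) k))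
      (c₀ : MvPolynomial (Fin n) k), c₀ ∉ 𝔮 ∧ ∀ i j, D i (g j) - (if j = i then c₀ else 0) ∈ 𝔮 := by
  classical
  haveI : IsScalarTower (MvPolynomial (Fin n) k) (Localization.AtPrime 𝔮) 𝔮.ResidueField :=
    IsScalarTower.of_algebraMap_eq' rfl
  -- Step 1: coordinate functionals `φ_i` with `φ_i(ḡ_j) = δ_ij` (extend from the span).
  set v : Fin r → CotangentSpace (Localization.AtPrime 𝔮) := fun j =>
    (maximalIdeal (Localization.AtPrime 𝔮)).toCotangent ⟨_, hg j⟩ with hv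
  have hφ : ∀ i, ∃ φ : CotangentSpace (Localization.AtPrime 𝔮) →ₗ[𝔮.ResidueField] 𝔮.ResidueField,
      ∀ j, φ (v j) = if j = i then 1 else 0 := by
    intro i
    let bW := Module.Basis.span hli
    obtain ⟨φ, hφ⟩ := LinearMap.exists_extend (bW.coord i)
    refine ⟨φ, fun j => ?_⟩
    have hj : (⟨v j, Submodule.subset_span ⟨j, rfl⟩⟩ :
        Submodule.span 𝔮.ResidueField (Set.range v)) = bW j :=
      Subtype.ext (by rw [Module.Basis.span_apply])
    have := LinearMap.congr_fun hφ ⟨v j, Submodule.subset_span ⟨j, rfl⟩⟩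
    rw [LinearMap.comp_apply, Submodule.subtype_apply] at this
    rw [this, hj, Module.Basis.coord_apply, Module.Basis.repr_self, Finsupp.single_apply]
  choose φ hφ using hφ
  -- Step 2: derivations `E_i : S_𝔮 → κ(𝔮)` with `E_i(g_j) = δ_ij` (Cohen), pulled back to `S`.
  choose E hEadd hEmul hE using fun i : Fin r => exists_derivation_apply_eq k (φ i)
  have hEf : ∀ i j, E i (algebraMap _ (Localization.AtPrime 𝔮) (g j)) = if j = i then 1 else 0 :=
    fun i j => by rw [hE i ⟨_, hg j⟩, ← hφ i j]
  have hE0 : ∀ i, E i 0 = 0 := fun i => by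
    have h := hEadd i 0 0
    rw [add_zero] at h
    exact left_eq_add.mp h
  have hE'ex : ∀ i : Fin r, ∃ E'i : Derivation ℤ (MvPolynomial (Fin n) k) 𝔮.ResidueField,
      ∀ s, E'i s = E i (algebraMap _ (Localization.AtPrime 𝔮) s) := fun i =>
    exists_derivation_of_leibniz
      { toFun := fun s => E i (algebraMap _ (Localization.AtPrime 𝔮) s)
        map_zero' := by rw [map_zero, hE0]
        map_add' := fun a b => by rw [map_add, hEadd] }
      fun a b => by
        change E i (algebraMap _ (Localization.AtPrime 𝔮) (a * b)) =
          a • E i (algebraMap _ (Localization.AtPrime 𝔮) b) +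
            b • E i (algebraMap _ (Localization.AtPrime 𝔮) a)
        rw [map_mul, hEmul, algebraMap_smul, algebraMap_smul]
  choose E' hE'apply using hE'ex
  -- Step 3: a common denominator `c ∉ 𝔮` for the finitely many relevant values of the `E'_i`.
  set Cf : Finset k := (Finset.univ : Finset (Fin r)).biUnion fun j => (g j).coeffs with hCf
  set vals : Finset 𝔮.ResidueField := (Finset.univ : Finset (Fin r)).biUnion fun i =>
    Cf.image (fun c => E' i (C c)) ∪ (Finset.univ : Finset (Fin n)).image fun l => E' i (X l)
    with hvals
  have hCvals : ∀ i, ∀ c ∈ Cf, E' i (C c) ∈ vals := fun i c hc => by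
    rw [hvals, Finset.mem_biUnion]
    exact ⟨i, Finset.mem_univ _, Finset.mem_union_left _ (Finset.mem_image_of_mem _ hc)⟩
  have hXvals : ∀ i l, E' i (X l) ∈ vals := fun i l => by
    rw [hvals, Finset.mem_biUnion]
    exact ⟨i, Finset.mem_univ _, Finset.mem_union_right _
      (Finset.mem_image_of_mem _ (Finset.mem_univ l))⟩
  have hcoeffCf : ∀ j, ∀ c ∈ (g j).coeffs, c ∈ Cf := fun j c hc => by
    rw [hCf, Finset.mem_biUnion]
    exact ⟨j, Finset.mem_univ _, hc⟩
  obtain ⟨d, hd⟩ := IsLocalization.exist_integer_multiples_of_finset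
    (nonZeroDivisors (MvPolynomial (Fin n) k ⧸ 𝔮)) vals
  obtain ⟨c, hc⟩ := Ideal.Quotient.mk_surjective (d : MvPolynomial (Fin n) k ⧸ 𝔮)
  have hcP : c ∉ 𝔮 := fun h => by
    have : (d : MvPolynomial (Fin n) k ⧸ 𝔮) = 0 := by
      rw [← hc]; exact Ideal.Quotient.eq_zero_iff_mem.mpr h
    exact nonZeroDivisors.coe_ne_zero d this
  set cK : 𝔮.ResidueField := algebraMap (MvPolynomial (Fin n) k) 𝔮.ResidueField c with hcK
  have hint : ∀ a ∈ vals, ∃ s : MvPolynomial (Fin n) k,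
      algebraMap (MvPolynomial (Fin n) k) 𝔮.ResidueField s = cK * a := fun a ha => by
    obtain ⟨x, hx⟩ := hd a ha
    obtain ⟨s, rfl⟩ := Ideal.Quotient.mk_surjective x
    refine ⟨s, ?_⟩
    rw [Ideal.algebraMap_quotient_residueField_mk] at hx
    rw [hx, Algebra.smul_def, ← hc, Ideal.algebraMap_quotient_residueField_mk]
  let lift : 𝔮.ResidueField → MvPolynomial (Fin n) k := fun a =>
    if h : ∃ s : MvPolynomial (Fin n) k, algebraMap _ 𝔮.ResidueField s = cK * a then h.choose
    else 0
  have hlift : ∀ a ∈ vals, algebraMap _ 𝔮.ResidueField (lift a) = cK * a := fun a ha => by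
    simp only [lift, dif_pos (hint a ha)]
    exact (hint a ha).choose_spec
  -- Step 4: derivations `δ_i` of `k` into `S` approximating `E'_i ∘ C` on `Cf` modulo `𝔮`,
  -- via a `k`-basis of `Ω_{k/ℤ}` adapted to the differentials of the elements of `Cf`.
  set dset : Set (Ω[k⁄ℤ]) := (fun c => KaehlerDifferential.D ℤ k c) '' (Cf : Set k) with hdset
  obtain ⟨t₂, ht₂sub, ht₂span, hli₂⟩ := exists_linearIndependent k dset
  have hli₂' : LinearIndepOn k id t₂ := hli₂
  set B := Module.Basis.extend hli₂' with hB
  have hdkex : ∀ i : Fin r, ∃ dki : Derivation ℤ k 𝔮.ResidueField, ∀ a, dki a = E' i (C a) :=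
    fun i => exists_derivation_of_leibniz
      { toFun := fun a => E' i (C a)
        map_zero' := by rw [C_0, map_zero]
        map_add' := fun a b => by rw [C_add, map_add] }
      fun a b => by
        change E' i (C (a * b)) = a • E' i (C b) + b • E' i (C a)
        rw [C_mul, Derivation.leibniz, ← MvPolynomial.algebraMap_eq, algebraMap_smul,
          algebraMap_smul]
  choose dk hdk using hdkex
  let lam : Fin r → (Ω[k⁄ℤ] →ₗ[k] 𝔮.ResidueField) := fun i => (dk i).liftKaehlerDifferential
  have hlam : ∀ i a, lam i (KaehlerDifferential.D ℤ k a) = E' i (C a) := fun i a => by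
    rw [Derivation.liftKaehlerDifferential_comp_D, hdk]
  let μ : Fin r → (Ω[k⁄ℤ] →ₗ[k] MvPolynomial (Fin n) k) := fun i =>
    B.constr k fun w => lift (lam i (w : Ω[k⁄ℤ]))
  have hμ : ∀ i, ∀ c ∈ Cf, algebraMap _ 𝔮.ResidueField (μ i (KaehlerDifferential.D ℤ k c)) =
      cK * E' i (C c) := by
    intro i c hc
    have hmem : KaehlerDifferential.D ℤ k c ∈ Submodule.span k t₂ := by
      rw [ht₂span]
      exact Submodule.subset_span ⟨c, hc, rfl⟩
    have heq : Set.EqOn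
        (((Algebra.linearMap (MvPolynomial (Fin n) k) 𝔮.ResidueField).restrictScalars k) ∘ₗ μ i)
        (cK • lam i : Ω[k⁄ℤ] →ₗ[k] 𝔮.ResidueField) t₂ := by
      intro w hw
      obtain ⟨c', hc', rfl⟩ := ht₂sub hw
      have hBw : B ⟨KaehlerDifferential.D ℤ k c', Module.Basis.subset_extend hli₂' hw⟩ =
          KaehlerDifferential.D ℤ k c' := Module.Basis.extend_apply_self hli₂' _
      change algebraMap _ 𝔮.ResidueField (μ i (KaehlerDifferential.D ℤ k c')) =
        cK * lam i (KaehlerDifferential.D ℤ k c')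
      rw [← hBw]
      change algebraMap _ 𝔮.ResidueField (B.constr k (fun w => lift (lam i (w : Ω[k⁄ℤ])))
        (B ⟨KaehlerDifferential.D ℤ k c', _⟩)) = _
      rw [Module.Basis.constr_basis, hBw, hlam]
      exact hlift _ (hCvals i c' hc')
    have := LinearMap.eqOn_span heq hmem
    rw [← hlam]
    exact this
  let δ : Fin r → Derivation ℤ k (MvPolynomial (Fin n) k) := fun i =>
    (μ i).compDer (KaehlerDifferential.D ℤ k)
  have hδ : ∀ i a, δ i a = μ i (KaehlerDifferential.D ℤ k a) := fun i a => rfl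
  -- Step 5: the derivations `D_i ∈ Der(S)` and the congruence `D_i(g_j) ≡ c E'_i(g_j) mod 𝔮`.
  choose D hDC hDX using fun i =>
    MvPolynomial.exists_derivation_C_eq_X_eq (T := MvPolynomial (Fin n) k) (δ i)
      fun l => lift (E' i (X l))
  have hcong : ∀ i j, algebraMap _ 𝔮.ResidueField (D i (g j)) = cK * E' i (g j) := by
    intro i j
    let Δ₁ : Derivation ℤ (MvPolynomial (Fin n) k) 𝔮.ResidueField :=
      (Algebra.linearMap (MvPolynomial (Fin n) k) 𝔮.ResidueField).compDer (D i)
    have h := MvPolynomial.derivation_apply_eq_of_eqOn Δ₁ (cK • E' i) (g j)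
      (fun a ha => ?_) (fun l => ?_)
    · exact h
    · change algebraMap _ 𝔮.ResidueField (D i (C a)) = cK • E' i (C a)
      rw [hDC, hδ, smul_eq_mul]
      exact hμ i a (hcoeffCf j a ha)
    · change algebraMap _ 𝔮.ResidueField (D i (X l)) = cK • E' i (X l)
      rw [hDX, smul_eq_mul]
      exact hlift _ (hXvals i l)
  -- Step 6: read off `D_i(g_j) - c δ_ij ∈ 𝔮`.
  refine ⟨D, c, hcP, fun i j => ?_⟩
  rw [← Ideal.algebraMap_residueField_eq_zero, map_sub, sub_eq_zero]
  refine (hcong i j).trans ?_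
  rw [hE'apply, hEf]
  by_cases hji : j = i
  · rw [if_pos hji, if_pos hji, mul_one, hcK]
  · rw [if_neg hji, if_neg hji, mul_zero, map_zero]

end Jacobian

/-! ## Extending derivations to a localization and descending them along a surjection -/

section Transport

variable {k : Type u} [Field k] {n : ℕ}

/-- **A derivation of `S = k[X]` extends to `S_𝔮`** (Stacks 07PE (2), through
`Ω_{S_𝔮} = (Ω_S)_𝔮`; `DerivationCompletion.exists_derivation_extend_of_isLocalizedModule`).
(The Stacks Project, Tag 07PE (2).) [folklore] -/
theorem exists_derivation_localization (𝔮 : Ideal (MvPolynomial (Fin n) k)) [𝔮.IsPrime]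
    (D : Derivation ℤ (MvPolynomial (Fin n) k) (MvPolynomial (Fin n) k)) :
    ∃ DQ : Derivation ℤ (Localization.AtPrime 𝔮) (Localization.AtPrime 𝔮),
      ∀ F, DQ (algebraMap _ _ F) = algebraMap _ _ (D F) :=
  exists_derivation_extend_of_isLocalizedModule 𝔮.primeCompl (Localization.AtPrime 𝔮)
    (Algebra.linearMap (MvPolynomial (Fin n) k) (Localization.AtPrime 𝔮)) D

/-- **A derivation preserving the kernel of a surjection descends**: if `φ : Q → R` is a
surjective ring homomorphism and `Δ ∈ Der(Q)` maps `ker φ` into `ker φ`, there is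
`Δ' ∈ Der(R)` with `Δ' ∘ φ = φ ∘ Δ`. [folklore] -/
theorem exists_derivation_of_surjective {Q : Type v} [CommRing Q] [Algebra ℤ Q] {R : Type u}
    [CommRing R] [Algebra ℤ R] (φ : Q →+* R) (hφ : Function.Surjective φ)
    (Δ : Derivation ℤ Q Q) (hΔ : ∀ z, φ z = 0 → φ (Δ z) = 0) :
    ∃ Δ' : Derivation ℤ R R, ∀ z, Δ' (φ z) = φ (Δ z) := by
  set σ := Function.surjInv hφ with hσ
  have hσφ : ∀ r, φ (σ r) = r := Function.surjInv_eq hφ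
  have key : ∀ z z', φ z = φ z' → φ (Δ z) = φ (Δ z') := fun z z' h => by
    rw [← sub_eq_zero, ← map_sub, ← map_sub]
    exact hΔ _ (by rw [map_sub, h, sub_self])
  let f : R →+ R :=
    { toFun := fun r => φ (Δ (σ r))
      map_zero' := by rw [key (σ 0) 0 (by rw [hσφ, map_zero]), map_zero, map_zero]
      map_add' := fun a b => by
        rw [key (σ (a + b)) (σ a + σ b) (by rw [map_add, hσφ, hσφ, hσφ]), map_add, map_add] }
  have hf : ∀ r, f r = φ (Δ (σ r)) := fun r => rfl
  obtain ⟨D, hD⟩ := exists_derivation_of_leibniz f fun a b => by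
    rw [hf, hf, hf, key (σ (a * b)) (σ a * σ b) (by rw [map_mul, hσφ, hσφ, hσφ]),
      Derivation.leibniz, map_add, smul_eq_mul, smul_eq_mul, map_mul, map_mul, hσφ, hσφ,
      smul_eq_mul, smul_eq_mul]
  refine ⟨D, fun z => ?_⟩
  rw [hD, hf]
  exact key _ _ (hσφ _)

end Transport

/-- **Registered sub-goal `pthPowerModMonomial_derivation_descends`** (closed form of
`exists_derivation_of_surjective`, for `--supports` registration): a derivation preserving the
kernel of a surjection descends. [folklore] -/
theorem pthPowerModMonomial_derivation_descends : ∀ {Q : Type*} [CommRing Q] [Algebra ℤ Q] {R : Type*} [CommRing R] [Algebra ℤ R] (φ : Q →+* R), Function.Surjective φ → ∀ (Δ : Derivation ℤ Q Q), (∀ z, φ z = 0 → φ (Δ z) = 0) → ∃ Δ' : Derivation ℤ R R, ∀ z, Δ' (φ z) = φ (Δ z) :=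
  fun φ hφ Δ hΔ => exists_derivation_of_surjective φ hφ Δ hΔ

end Summit.ResolutionOfSingularities.ResolutionOfSingularities.Theorems.PfaffLine
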